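import Mathlib.Analysis.SpecialFunctions.Gamma.Beta
import Mathlib.Analysis.SpecialFunctions.Gaussian.GaussianIntegral
import Mathlib.Analysis.Calculus.ParametricIntegral
import Mathlib.MeasureTheory.Integral.IntegralEqImproper
import Mathlib.Analysis.SpecialFunctions.Pow.Deriv
import Mathlib.Analysis.Complex.CauchyIntegral
import HarnessLib

/-!
# Tricomi's confluent hypergeometric function `U(a,b,z)` by its integral representation:
# convergence, holomorphy, the derivative formula and Kummer's equation on `Re z > 0`

For complex parameters with `Re a > 0` and `Re z > 0` the Laplace-type integral

  `U(a,b,z) = (1/Γ(a)) ∫₀^∞ e^{−zt} t^{a−1} (1+t)^{b−a−1} dt`                    (DLMF 13.4.4)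

(principal powers of the positive reals `t`, `1+t`) converges absolutely and defines the Tricomi
(second Kummer) function. Mathlib (v4.32) has no confluent hypergeometric functions; this file
lays the foundation the far-face (Coulomb/Whittaker) model of the near-extremal Kerr threshold
problem needs (`Literature/Geometry/Lorentzian/ExtremalKerrThresholdCoulomb.lean`), restricted
to the open half-plane `{Re z > 0}` (no analytic continuation in `z` or `a` is attempted):

* `tricomiIntegrand`, `tricomiIntegral` (without the Gamma prefactor), `tricomiU`;
* `norm_tricomiIntegrand`, `integrableOn_tricomiIntegrand` — absolute convergence for
  `Re a > 0`, `Re z > 0` (domination by two Gamma-type integrands `t^s e^{−xt}`, using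
  `(1+t)^p ≤ 2^p (1 + t^p)`);
* `hasDerivAt_tricomiIntegral` — holomorphy in `z` by dominated differentiation under the
  integral sign (`d/dz` brings down `−t`): `I(a,b)′ = −I(a+1,b+1)`;
* `hasDerivAt_tricomiU` — **DLMF 13.3.22**: `U′(a,b,z) = −a U(a+1,b+1,z)`; `deriv_tricomiU`,
  `deriv_deriv_tricomiU`, `differentiableOn_tricomiU`, `analyticOnNhd_tricomiU`;
* `tricomiIntegral_kummer`, `tricomiU_kummer`, `tricomiU_kummer_hasDerivAt`,
  `tricomiU_kummer_deriv` — **KUMMER'S EQUATION, DLMF 13.2.1**: `z w″ + (b − z) w′ − a w = 0`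
  for `w = U(a,b,·)` on `Re z > 0`, proved by one integration by parts in `t`: the residual is
  `−∫₀^∞ d/dt [e^{−zt} t^{a} (1+t)^{b−a}] dt`, whose boundary terms vanish (`Re a > 0` at `0`;
  at `∞` because the bracket and its derivative are integrable).

Design: `tricomiU a b z := tricomiIntegral a b z / Γ(a)` is DLMF's `U` only where the integral
converges (`Re a > 0`, `Re z > 0`); elsewhere it is a junk value and nothing is claimed. The
connection with Kummer's `M` (DLMF 13.2.42), the large-`z` asymptotics (13.7.3) and the rotation
to `|ph z| < 3π/2` are NOT in this file.

References: NIST DLMF 13.4.4, 13.3.22, 13.2.1 [DLMF].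
-/

noncomputable section

open Filter Metric MeasureTheory Set
open scoped Topology

namespace Literature.Analysis.SpecialFunctions.Confluent

/-! ### Definitions -/

/-- The Tricomi integrand `e^{−zt} t^{a−1} (1+t)^{b−a−1}` (principal complex powers of the real
`t > 0`). [cite: DLMF, 13.4.4] -/
def tricomiIntegrand (a b z : ℂ) (t : ℝ) : ℂ :=
  Complex.exp (-(z * t)) * (t : ℂ) ^ (a - 1) * (1 + (t : ℂ)) ^ (b - a - 1)

/-- The Tricomi integral `∫₀^∞ e^{−zt} t^{a−1} (1+t)^{b−a−1} dt` WITHOUT the prefactor `1/Γ(a)`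
(Bochner integral over `(0,∞)`; junk where it diverges). [cite: DLMF, 13.4.4] -/
def tricomiIntegral (a b z : ℂ) : ℂ :=
  ∫ t in Ioi (0 : ℝ), tricomiIntegrand a b z t

/-- **Tricomi's confluent hypergeometric function** `U(a,b,z) = (1/Γ(a)) ∫₀^∞ e^{−zt} t^{a−1}
(1+t)^{b−a−1} dt`, valid for `Re a > 0`, `Re z > 0` (a junk value elsewhere; no continuation is
claimed). [cite: DLMF, 13.4.4] -/
def tricomiU (a b z : ℂ) : ℂ :=
  tricomiIntegral a b z / Complex.Gamma a

/-! ### Pointwise facts about the integrand -/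

/-- `1 + t` lies in the slit plane for real `t > −1`. [folklore] -/
theorem one_add_ofReal_mem_slitPlane {t : ℝ} (ht : -1 < t) : 1 + (t : ℂ) ∈ Complex.slitPlane :=
  Complex.mem_slitPlane_iff.2 (Or.inl (by simp; linarith))

/-- The modulus of the Tricomi integrand: `‖e^{−zt} t^{a−1}(1+t)^{b−a−1}‖ =
e^{−(Re z)t} t^{Re a − 1} (1+t)^{Re b − Re a − 1}` for `t > 0`. [folklore] -/
theorem norm_tricomiIntegrand (a b z : ℂ) {t : ℝ} (ht : 0 < t) :
    ‖tricomiIntegrand a b z t‖ =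
      Real.exp (-(z.re * t)) * t ^ (a.re - 1) * (1 + t) ^ (b.re - a.re - 1) := by
  have h1 : (1 : ℂ) + (t : ℂ) = ((1 + t : ℝ) : ℂ) := by push_cast; ring
  rw [tricomiIntegrand, norm_mul, norm_mul, Complex.norm_exp, h1,
    Complex.norm_cpow_eq_rpow_re_of_pos ht, Complex.norm_cpow_eq_rpow_re_of_pos (by linarith)]
  simp [Complex.mul_re]

/-- The Tricomi integrand is continuous on `(0, ∞)`. [folklore] -/
theorem continuousOn_tricomiIntegrand (a b z : ℂ) :
    ContinuousOn (tricomiIntegrand a b z) (Ioi 0) := by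
  intro t ht
  have h0 : ContinuousAt (fun s : ℝ => Complex.exp (-(z * s))) t := by fun_prop
  have h1 : ContinuousAt (fun s : ℝ => (s : ℂ) ^ (a - 1)) t :=
    (continuousAt_cpow_const (Complex.ofReal_mem_slitPlane.2 ht)).comp
      Complex.continuous_ofReal.continuousAt
  have h2 : ContinuousAt (fun s : ℝ => (1 + (s : ℂ)) ^ (b - a - 1)) t :=
    ContinuousAt.cpow (f := fun s : ℝ => 1 + (s : ℂ)) (g := fun _ => b - a - 1) (by fun_prop)
      continuousAt_const (one_add_ofReal_mem_slitPlane (by linarith [mem_Ioi.1 ht]))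
  exact ((h0.mul h1).mul h2).continuousWithinAt

/-- Raising both parameters multiplies the integrand by `t`:
`F(a+1,b+1;z;t) = t · F(a,b;z;t)` for `t > 0`. [folklore] -/
theorem tricomiIntegrand_succ (a b z : ℂ) {t : ℝ} (ht : 0 < t) :
    tricomiIntegrand (a + 1) (b + 1) z t = (t : ℂ) * tricomiIntegrand a b z t := by
  have hT : (t : ℂ) ≠ 0 := Complex.ofReal_ne_zero.2 ht.ne'
  simp only [tricomiIntegrand]
  rw [show a + 1 - 1 = (a - 1) + 1 by ring, Complex.cpow_add _ _ hT, Complex.cpow_one,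
    show b + 1 - (a + 1) - 1 = b - a - 1 by ring]
  ring

/-- The `z`-derivative of the integrand: `d/dz F(a,b;z;t) = −t F(a,b;z;t)`. [folklore] -/
theorem hasDerivAt_tricomiIntegrand (a b z : ℂ) (t : ℝ) :
    HasDerivAt (fun w : ℂ => tricomiIntegrand a b w t) (-(t : ℂ) * tricomiIntegrand a b z t) z := by
  have h1 : HasDerivAt (fun w : ℂ => -(w * (t : ℂ))) (-(1 * (t : ℂ))) z :=
    ((hasDerivAt_id' z).mul_const (t : ℂ)).neg
  have h2 := ((h1.cexp).mul_const ((t : ℂ) ^ (a - 1))).mul_const ((1 + (t : ℂ)) ^ (b - a - 1))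
  simp only [tricomiIntegrand]
  refine h2.congr_deriv ?_
  ring

/-- Monotonicity of the modulus in `Re z`: `‖F(a,b;z;t)‖ ≤ ‖F(a,b;w;t)‖` whenever `Re w ≤ Re z`
(`t > 0`). [folklore] -/
theorem norm_tricomiIntegrand_le_of_re_le (a b : ℂ) {z w : ℂ} (h : w.re ≤ z.re) {t : ℝ}
    (ht : 0 < t) : ‖tricomiIntegrand a b z t‖ ≤ ‖tricomiIntegrand a b w t‖ := by
  rw [norm_tricomiIntegrand a b z ht, norm_tricomiIntegrand a b w ht]
  gcongr

/-! ### Convergence -/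

/-- `(1 + t)^p ≤ 2^p (1 + t^p)` for `t ≥ 0`, `p ≥ 0`. [folklore] -/
private theorem one_add_rpow_le {t p : ℝ} (ht : 0 ≤ t) (hp : 0 ≤ p) :
    (1 + t) ^ p ≤ 2 ^ p * (1 + t ^ p) := by
  have h2p : 0 ≤ (2 : ℝ) ^ p := Real.rpow_nonneg (by norm_num) p
  have htp : 0 ≤ t ^ p := Real.rpow_nonneg ht p
  rcases le_total t 1 with h | h
  · calc (1 + t) ^ p ≤ 2 ^ p := Real.rpow_le_rpow (by linarith) (by linarith) hp
      _ ≤ 2 ^ p * (1 + t ^ p) := le_mul_of_one_le_right h2p (by linarith)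
  · calc (1 + t) ^ p ≤ (2 * t) ^ p := Real.rpow_le_rpow (by linarith) (by linarith) hp
      _ = 2 ^ p * t ^ p := Real.mul_rpow (by norm_num) ht
      _ ≤ 2 ^ p * (1 + t ^ p) := mul_le_mul_of_nonneg_left (by linarith) h2p

/-- The Gamma-type integrand `t^s e^{−xt}` is integrable on `(0,∞)` for `s > −1`, `x > 0`.
[folklore] -/
private theorem integrableOn_rpow_mul_exp_neg_mul {s x : ℝ} (hs : -1 < s) (hx : 0 < x) :
    IntegrableOn (fun t : ℝ => t ^ s * Real.exp (-(x * t))) (Ioi 0) := by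
  have h := integrableOn_rpow_mul_exp_neg_mul_rpow hs le_rfl hx
  simpa only [Real.rpow_one, neg_mul] using h

/-- **Convergence of the Tricomi integral**: for `Re a > 0` and `Re z > 0` the integrand
`e^{−zt} t^{a−1}(1+t)^{b−a−1}` is integrable on `(0,∞)` (endpoint `t^{Re a − 1}` at `0`,
exponential decay times a power at `∞`; dominated by `2^p (t^{Re a−1} + t^{Re a−1+p}) e^{−(Re z)t}`
with `p = max (Re b − Re a − 1) 0`). [cite: DLMF, 13.4.4] -/
theorem integrableOn_tricomiIntegrand {a : ℂ} (b : ℂ) {z : ℂ} (ha : 0 < a.re) (hz : 0 < z.re) :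
    IntegrableOn (tricomiIntegrand a b z) (Ioi 0) := by
  set p : ℝ := max (b.re - a.re - 1) 0 with hp
  have hp0 : 0 ≤ p := le_max_right _ _
  have hg : IntegrableOn (fun t : ℝ => 2 ^ p * (t ^ (a.re - 1) * Real.exp (-(z.re * t))) +
      2 ^ p * (t ^ (a.re - 1 + p) * Real.exp (-(z.re * t)))) (Ioi 0) :=
    ((integrableOn_rpow_mul_exp_neg_mul (by linarith) hz).const_mul _).add
      ((integrableOn_rpow_mul_exp_neg_mul (by linarith) hz).const_mul _)
  refine Integrable.mono' hg
    ((continuousOn_tricomiIntegrand a b z).aestronglyMeasurable measurableSet_Ioi) ?_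
  refine (ae_restrict_iff' measurableSet_Ioi).2 (ae_of_all _ fun t (ht : 0 < t) => ?_)
  rw [norm_tricomiIntegrand a b z ht]
  have h1 : (1 + t) ^ (b.re - a.re - 1) ≤ 2 ^ p * (1 + t ^ p) :=
    (Real.rpow_le_rpow_of_exponent_le (by linarith) (le_max_left _ _)).trans
      (one_add_rpow_le ht.le hp0)
  have hE : 0 ≤ Real.exp (-(z.re * t)) * t ^ (a.re - 1) := by positivity
  calc Real.exp (-(z.re * t)) * t ^ (a.re - 1) * (1 + t) ^ (b.re - a.re - 1)
      ≤ Real.exp (-(z.re * t)) * t ^ (a.re - 1) * (2 ^ p * (1 + t ^ p)) :=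
        mul_le_mul_of_nonneg_left h1 hE
    _ = 2 ^ p * (t ^ (a.re - 1) * Real.exp (-(z.re * t))) +
        2 ^ p * (t ^ (a.re - 1 + p) * Real.exp (-(z.re * t))) := by
        rw [Real.rpow_add ht]; ring

/-! ### Holomorphy in `z`: differentiation under the integral sign -/

/-- Points of `ball z₀ ρ` have `Re z > Re z₀ − ρ`. [folklore] -/
theorem re_gt_of_mem_ball {z₀ z : ℂ} {ρ : ℝ} (hz : z ∈ ball z₀ ρ) : z₀.re - ρ < z.re := by
  have h1 : ‖z - z₀‖ < ρ := mem_ball_iff_norm.1 hz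
  have h2 : |(z - z₀).re| < ρ := lt_of_le_of_lt (Complex.abs_re_le_norm _) h1
  rw [Complex.sub_re, abs_lt] at h2
  linarith [h2.1]

/-- The half-plane `{Re z > 0}` is open. [folklore] -/
private theorem isOpen_re_pos : IsOpen {z : ℂ | 0 < z.re} :=
  isOpen_lt continuous_const Complex.continuous_re

/-- Shifting a parameter by a natural number keeps the real part positive. [folklore] -/
private theorem re_add_pos {a : ℂ} (ha : 0 < a.re) (n : ℕ) : 0 < (a + n).re := by
  simp; positivity

/-- **Holomorphy of the Tricomi integral**: for `Re a > 0` and `Re z₀ > 0`,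
`d/dz ∫₀^∞ e^{−zt} t^{a−1}(1+t)^{b−a−1} dt = −∫₀^∞ e^{−zt} t^{a}(1+t)^{b−a−1} dt` at `z₀`, i.e.
`(tricomiIntegral a b)′(z₀) = −tricomiIntegral (a+1) (b+1) z₀` (dominated differentiation under
the integral sign on the ball of radius `Re z₀ / 2`, dominated by the modulus of the integrand at
the real point `Re z₀ / 2`). [cite: DLMF, 13.4.4] -/
theorem hasDerivAt_tricomiIntegral {a : ℂ} (b : ℂ) (ha : 0 < a.re) {z₀ : ℂ} (hz₀ : 0 < z₀.re) :
    HasDerivAt (tricomiIntegral a b) (-tricomiIntegral (a + 1) (b + 1) z₀) z₀ := by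
  set ρ : ℝ := z₀.re / 2 with hρ
  have hρ0 : 0 < ρ := by rw [hρ]; linarith
  have hball : ∀ z ∈ ball z₀ ρ, ρ < z.re := fun z hz => by
    have h := re_gt_of_mem_ball hz; rw [hρ] at h ⊢; linarith
  have ha1 : 0 < (a + 1).re := by simpa using re_add_pos ha 1
  have hρre : 0 < (ρ : ℂ).re := by simpa using hρ0
  have hF_meas : ∀ᶠ z in 𝓝 z₀,
      AEStronglyMeasurable (tricomiIntegrand a b z) (volume.restrict (Ioi 0)) :=
    Filter.Eventually.of_forall fun z =>
      (continuousOn_tricomiIntegrand a b z).aestronglyMeasurable measurableSet_Ioi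
  have hF_int : Integrable (tricomiIntegrand a b z₀) (volume.restrict (Ioi 0)) :=
    integrableOn_tricomiIntegrand b ha hz₀
  have hF'_meas : AEStronglyMeasurable (fun t : ℝ => -tricomiIntegrand (a + 1) (b + 1) z₀ t)
      (volume.restrict (Ioi 0)) :=
    (continuousOn_tricomiIntegrand (a + 1) (b + 1) z₀).neg.aestronglyMeasurable measurableSet_Ioi
  have h_bound : ∀ᵐ t ∂(volume.restrict (Ioi 0)), ∀ z ∈ ball z₀ ρ,
      ‖-tricomiIntegrand (a + 1) (b + 1) z t‖ ≤ ‖tricomiIntegrand (a + 1) (b + 1) (ρ : ℂ) t‖ :=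
    (ae_restrict_iff' measurableSet_Ioi).2 (ae_of_all _ fun t (ht : 0 < t) z hz => by
      rw [norm_neg]
      exact norm_tricomiIntegrand_le_of_re_le (a + 1) (b + 1) (by simpa using (hball z hz).le) ht)
  have bound_integrable : Integrable (fun t : ℝ => ‖tricomiIntegrand (a + 1) (b + 1) (ρ : ℂ) t‖)
      (volume.restrict (Ioi 0)) := (integrableOn_tricomiIntegrand (b + 1) ha1 hρre).norm
  have h_diff : ∀ᵐ t ∂(volume.restrict (Ioi 0)), ∀ z ∈ ball z₀ ρ,
      HasDerivAt (fun w : ℂ => tricomiIntegrand a b w t) (-tricomiIntegrand (a + 1) (b + 1) z t) z :=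
    (ae_restrict_iff' measurableSet_Ioi).2 (ae_of_all _ fun t (ht : 0 < t) z _ => by
      rw [tricomiIntegrand_succ a b z ht, ← neg_mul]
      exact hasDerivAt_tricomiIntegrand a b z t)
  have hmain := (hasDerivAt_integral_of_dominated_loc_of_deriv_le (ball_mem_nhds z₀ hρ0)
    hF_meas hF_int hF'_meas h_bound bound_integrable h_diff).2
  rwa [integral_neg] at hmain

/-- **DLMF 13.3.22** on `Re z > 0` (`Re a > 0`): `d/dz U(a,b,z) = −a U(a+1,b+1,z)` (from
`hasDerivAt_tricomiIntegral` and `Γ(a+1) = a Γ(a)`). [cite: DLMF, 13.3.22] -/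
theorem hasDerivAt_tricomiU {a : ℂ} (b : ℂ) (ha : 0 < a.re) {z : ℂ} (hz : 0 < z.re) :
    HasDerivAt (tricomiU a b) (-a * tricomiU (a + 1) (b + 1) z) z := by
  have h := (hasDerivAt_tricomiIntegral b ha hz).div_const (Complex.Gamma a)
  refine h.congr_deriv ?_
  have ha0 : a ≠ 0 := fun h => by rw [h, Complex.zero_re] at ha; exact lt_irrefl _ ha
  have hΓ : Complex.Gamma a ≠ 0 := Complex.Gamma_ne_zero_of_re_pos ha
  rw [tricomiU, Complex.Gamma_add_one a ha0]
  field_simp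

/-- `deriv` form of DLMF 13.3.22 on `Re z > 0`. [cite: DLMF, 13.3.22] -/
theorem deriv_tricomiU {a : ℂ} (b : ℂ) (ha : 0 < a.re) {z : ℂ} (hz : 0 < z.re) :
    deriv (tricomiU a b) z = -a * tricomiU (a + 1) (b + 1) z :=
  (hasDerivAt_tricomiU b ha hz).deriv

/-- The second derivative: `U″(a,b,z) = a(a+1) U(a+2,b+2,z)` on `Re z > 0` (DLMF 13.3.23 with
`n = 2`). [cite: DLMF, 13.3.23] -/
theorem deriv_deriv_tricomiU {a : ℂ} (b : ℂ) (ha : 0 < a.re) {z : ℂ} (hz : 0 < z.re) :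
    deriv (deriv (tricomiU a b)) z = a * (a + 1) * tricomiU (a + 2) (b + 2) z := by
  have ha1 : 0 < (a + 1).re := by simpa using re_add_pos ha 1
  have h : deriv (tricomiU a b) =ᶠ[𝓝 z] fun w => -a * tricomiU (a + 1) (b + 1) w :=
    Filter.eventually_of_mem (isOpen_re_pos.mem_nhds hz) fun w hw => deriv_tricomiU b ha hw
  rw [h.deriv_eq, ((hasDerivAt_tricomiU (b + 1) ha1 hz).const_mul (-a)).deriv,
    show a + 1 + 1 = a + 2 by ring, show b + 1 + 1 = b + 2 by ring]
  ring

/-- `U(a,b,·)` is complex-differentiable on `{Re z > 0}` for `Re a > 0`. [cite: DLMF, 13.4.4] -/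
theorem differentiableOn_tricomiU {a : ℂ} (b : ℂ) (ha : 0 < a.re) :
    DifferentiableOn ℂ (tricomiU a b) {z : ℂ | 0 < z.re} := fun _ hz =>
  (hasDerivAt_tricomiU b ha hz).differentiableAt.differentiableWithinAt

/-- `U(a,b,·)` is analytic on `{Re z > 0}` for `Re a > 0`. [cite: DLMF, 13.4.4] -/
theorem analyticOnNhd_tricomiU {a : ℂ} (b : ℂ) (ha : 0 < a.re) :
    AnalyticOnNhd ℂ (tricomiU a b) {z : ℂ | 0 < z.re} :=
  (differentiableOn_tricomiU b ha).analyticOnNhd isOpen_re_pos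

/-- `U(a,b,·)` is continuous on `{Re z > 0}` for `Re a > 0`. [cite: DLMF, 13.4.4] -/
theorem continuousOn_tricomiU {a : ℂ} (b : ℂ) (ha : 0 < a.re) :
    ContinuousOn (tricomiU a b) {z : ℂ | 0 < z.re} :=
  (differentiableOn_tricomiU b ha).continuousOn

/-! ### Kummer's equation by integration by parts -/

/-- The total `t`-derivative behind Kummer's equation: for `t > 0`,
`d/dt [e^{−zt} t^{a} (1+t)^{b−a}] = −z F(a+2,b+2;z;t) + (b − z) F(a+1,b+1;z;t) + a F(a,b;z;t)`
where `F = tricomiIntegrand` and `e^{−zt} t^{a}(1+t)^{b−a} = F(a+1,b+2;z;t)`. [folklore] -/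
theorem hasDerivAt_tricomiIntegrand_t (a b z : ℂ) {t : ℝ} (ht : 0 < t) :
    HasDerivAt (fun s : ℝ => tricomiIntegrand (a + 1) (b + 2) z s)
      (-z * tricomiIntegrand (a + 2) (b + 2) z t + (b - z) * tricomiIntegrand (a + 1) (b + 1) z t
        + a * tricomiIntegrand a b z t) t := by
  have hT : (t : ℂ) ≠ 0 := Complex.ofReal_ne_zero.2 ht.ne'
  have hTs : (t : ℂ) ∈ Complex.slitPlane := Complex.ofReal_mem_slitPlane.2 ht
  have hSs : 1 + (t : ℂ) ∈ Complex.slitPlane := one_add_ofReal_mem_slitPlane (by linarith)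
  have hS : 1 + (t : ℂ) ≠ 0 := Complex.slitPlane_ne_zero hSs
  have h_exp : HasDerivAt (fun s : ℝ => Complex.exp (-(z * s)))
      (Complex.exp (-(z * t)) * (-(z * 1))) t :=
    (((hasDerivAt_id' (t : ℂ)).const_mul z).neg.cexp).comp_ofReal
  have h_T : HasDerivAt (fun s : ℝ => (s : ℂ) ^ (a + 1 - 1))
      ((a + 1 - 1) * (t : ℂ) ^ (a + 1 - 1 - 1) * 1) t :=
    ((hasDerivAt_id' (t : ℂ)).cpow_const hTs).comp_ofReal
  have h_S : HasDerivAt (fun s : ℝ => (1 + (s : ℂ)) ^ (b + 2 - (a + 1) - 1))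
      ((b + 2 - (a + 1) - 1) * (1 + (t : ℂ)) ^ (b + 2 - (a + 1) - 1 - 1) * 1) t :=
    (((hasDerivAt_id' (t : ℂ)).const_add 1).cpow_const hSs).comp_ofReal
  have h := (h_exp.mul h_T).mul h_S
  simp only [tricomiIntegrand]
  refine h.congr_deriv ?_
  simp only [Pi.mul_apply]
  rw [show a + 1 - 1 - 1 = a - 1 by ring, show a + 1 - 1 = (a - 1) + 1 by ring,
    show a + 2 - 1 = (a - 1) + 2 by ring, show b + 2 - (a + 1) - 1 - 1 = b - a - 1 by ring,
    show b + 2 - (a + 1) - 1 = (b - a - 1) + 1 by ring, show b + 2 - (a + 2) - 1 = b - a - 1 by ring,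
    show b + 1 - (a + 1) - 1 = b - a - 1 by ring, Complex.cpow_add _ _ hT, Complex.cpow_add _ _ hT,
    Complex.cpow_add _ _ hS, Complex.cpow_one, Complex.cpow_one, Complex.cpow_two]
  ring

/-- The bracket `e^{−zt} t^{a}(1+t)^{b−a} = F(a+1,b+2;z;t)` is continuous at `t = 0` and
vanishes there (`Re a > 0`). [folklore] -/
theorem continuousAt_tricomiIntegrand_zero {a : ℂ} (b z : ℂ) (ha : 0 < a.re) :
    ContinuousAt (tricomiIntegrand (a + 1) (b + 2) z) 0 ∧ tricomiIntegrand (a + 1) (b + 2) z 0 = 0 := by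
  have ha' : 0 < (a + 1 - 1).re := by simpa using ha
  have ha0 : a ≠ 0 := fun h => by rw [h, Complex.zero_re] at ha; exact lt_irrefl _ ha
  refine ⟨?_, by simp [tricomiIntegrand, Complex.zero_cpow, ha0]⟩
  have h0 : ContinuousAt (fun s : ℝ => Complex.exp (-(z * s))) 0 := by fun_prop
  have h1 : Continuous (fun s : ℝ => (s : ℂ) ^ (a + 1 - 1)) :=
    Complex.continuous_ofReal_cpow_const ha'
  have h2 : ContinuousAt (fun s : ℝ => (1 + (s : ℂ)) ^ (b + 2 - (a + 1) - 1)) 0 :=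
    ContinuousAt.cpow (f := fun s : ℝ => 1 + (s : ℂ)) (g := fun _ => b + 2 - (a + 1) - 1)
      (by fun_prop) continuousAt_const (one_add_ofReal_mem_slitPlane (by norm_num))
  exact (h0.mul h1.continuousAt).mul h2

/-- **Kummer's equation for the Tricomi integral** (`Re a > 0`, `Re z > 0`): with
`I = tricomiIntegral`, `I(a,b)′ = −I(a+1,b+1)`, `I(a,b)″ = I(a+2,b+2)` one has
`z I(a+2,b+2) + (b − z)(−I(a+1,b+1)) − a I(a,b) = 0` — one integration by parts in `t`
(`hasDerivAt_tricomiIntegrand_t`; boundary terms vanish). [cite: DLMF, 13.2.1] -/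
theorem tricomiIntegral_kummer {a : ℂ} (b : ℂ) (ha : 0 < a.re) {z : ℂ} (hz : 0 < z.re) :
    z * tricomiIntegral (a + 2) (b + 2) z + (b - z) * (-tricomiIntegral (a + 1) (b + 1) z)
      - a * tricomiIntegral a b z = 0 := by
  have ha1 : 0 < (a + 1).re := by simpa using re_add_pos ha 1
  have ha2 : 0 < (a + 2).re := by simpa using re_add_pos ha 2
  have hI0 : Integrable (fun t => a * tricomiIntegrand a b z t) (volume.restrict (Ioi 0)) :=
    (integrableOn_tricomiIntegrand b ha hz).const_mul a
  have hI1 : Integrable (fun t => (b - z) * tricomiIntegrand (a + 1) (b + 1) z t)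
      (volume.restrict (Ioi 0)) := (integrableOn_tricomiIntegrand (b + 1) ha1 hz).const_mul _
  have hI2 : Integrable (fun t => -z * tricomiIntegrand (a + 2) (b + 2) z t)
      (volume.restrict (Ioi 0)) := (integrableOn_tricomiIntegrand (b + 2) ha2 hz).const_mul _
  have hI21 : Integrable (fun t => -z * tricomiIntegrand (a + 2) (b + 2) z t +
      (b - z) * tricomiIntegrand (a + 1) (b + 1) z t) (volume.restrict (Ioi 0)) := hI2.add hI1
  have hG : IntegrableOn (tricomiIntegrand (a + 1) (b + 2) z) (Ioi 0) :=
    integrableOn_tricomiIntegrand (b + 2) ha1 hz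
  have hG' : IntegrableOn (fun t : ℝ => -z * tricomiIntegrand (a + 2) (b + 2) z t +
      (b - z) * tricomiIntegrand (a + 1) (b + 1) z t + a * tricomiIntegrand a b z t) (Ioi 0) :=
    hI21.add hI0
  have hderiv : ∀ t ∈ Ioi (0 : ℝ), HasDerivAt (tricomiIntegrand (a + 1) (b + 2) z)
      (-z * tricomiIntegrand (a + 2) (b + 2) z t + (b - z) * tricomiIntegrand (a + 1) (b + 1) z t
        + a * tricomiIntegrand a b z t) t := fun t ht => hasDerivAt_tricomiIntegrand_t a b z ht
  have hlim : Tendsto (tricomiIntegrand (a + 1) (b + 2) z) atTop (𝓝 0) :=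
    tendsto_zero_of_hasDerivAt_of_integrableOn_Ioi hderiv hG' hG
  obtain ⟨hcont, h0⟩ := continuousAt_tricomiIntegrand_zero b z ha
  have hparts := integral_Ioi_of_hasDerivAt_of_tendsto hcont.continuousWithinAt hderiv hG' hlim
  rw [h0, sub_zero, integral_add hI21 hI0, integral_add hI2 hI1, integral_const_mul,
    integral_const_mul, integral_const_mul] at hparts
  simp only [tricomiIntegral]
  linear_combination -hparts

/-- **Kummer's equation, DLMF 13.2.1, for `w = U(a,b,·)` on `Re z > 0`** (`Re a > 0`), written
with the derivative formulas `w′ = −a U(a+1,b+1,·)` (13.3.22) and `w″ = a(a+1) U(a+2,b+2,·)`: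
`z w″ + (b − z) w′ − a w = 0`. [cite: DLMF, 13.2.1] -/
theorem tricomiU_kummer {a : ℂ} (b : ℂ) (ha : 0 < a.re) {z : ℂ} (hz : 0 < z.re) :
    z * (a * (a + 1) * tricomiU (a + 2) (b + 2) z) + (b - z) * (-a * tricomiU (a + 1) (b + 1) z)
      - a * tricomiU a b z = 0 := by
  have hI := tricomiIntegral_kummer b ha hz
  have ha0 : a ≠ 0 := fun h => by rw [h, Complex.zero_re] at ha; exact lt_irrefl _ ha
  have ha1 : 0 < (a + 1).re := by simpa using re_add_pos ha 1
  have ha10 : a + 1 ≠ 0 := fun h => by rw [h, Complex.zero_re] at ha1; exact lt_irrefl _ ha1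
  have hΓ : Complex.Gamma a ≠ 0 := Complex.Gamma_ne_zero_of_re_pos ha
  have hΓ1 : Complex.Gamma (a + 1) = a * Complex.Gamma a := Complex.Gamma_add_one _ ha0
  have hΓ2 : Complex.Gamma (a + 2) = (a + 1) * (a * Complex.Gamma a) := by
    rw [show a + 2 = (a + 1) + 1 by ring, Complex.Gamma_add_one _ ha10, hΓ1]
  simp only [tricomiU, hΓ1, hΓ2]
  field_simp
  linear_combination hI

/-- **DLMF 13.2.1 in pointwise `HasDerivAt` form** on `Re z > 0` (`Re a > 0`): with
`w′ z = −a U(a+1,b+1,z)` and `w″ z = a(a+1) U(a+2,b+2,z)`, `w = tricomiU a b` has derivative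
`w′ z`, `w′` has derivative `w″ z`, and `z w″ z + (b − z) w′ z − a w z = 0`. [cite: DLMF, 13.2.1] -/
theorem tricomiU_kummer_hasDerivAt {a : ℂ} (b : ℂ) (ha : 0 < a.re) {z : ℂ} (hz : 0 < z.re) :
    HasDerivAt (tricomiU a b) (-a * tricomiU (a + 1) (b + 1) z) z ∧
    HasDerivAt (fun w : ℂ => -a * tricomiU (a + 1) (b + 1) w)
      (a * (a + 1) * tricomiU (a + 2) (b + 2) z) z ∧
    z * (a * (a + 1) * tricomiU (a + 2) (b + 2) z) + (b - z) * (-a * tricomiU (a + 1) (b + 1) z)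
      - a * tricomiU a b z = 0 := by
  have ha1 : 0 < (a + 1).re := by simpa using re_add_pos ha 1
  refine ⟨hasDerivAt_tricomiU b ha hz, ?_, tricomiU_kummer b ha hz⟩
  have h := (hasDerivAt_tricomiU (b + 1) ha1 hz).const_mul (-a)
  rw [show a + 1 + 1 = a + 2 by ring, show b + 1 + 1 = b + 2 by ring] at h
  refine h.congr_deriv ?_
  ring

/-- **DLMF 13.2.1 with Mathlib's `deriv`** on `Re z > 0` (`Re a > 0`):
`z (U(a,b,·))″(z) + (b − z) (U(a,b,·))′(z) − a U(a,b,z) = 0`. [cite: DLMF, 13.2.1] -/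
theorem tricomiU_kummer_deriv {a : ℂ} (b : ℂ) (ha : 0 < a.re) {z : ℂ} (hz : 0 < z.re) :
    z * deriv (deriv (tricomiU a b)) z + (b - z) * deriv (tricomiU a b) z - a * tricomiU a b z
      = 0 := by
  rw [deriv_deriv_tricomiU b ha hz, deriv_tricomiU b ha hz]
  exact tricomiU_kummer b ha hz

end Literature.Analysis.SpecialFunctions.Confluent

end
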